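import Summits.ResolutionOfSingularities.ResolutionOfSingularities.Theorems.MarkedTransferCampaignW46ThreefoldsTauTwoSliceFiniteType
import Summits.ResolutionOfSingularities.ResolutionOfSingularities.Theorems.MarkedTransferCampaignW46ThreefoldsGammaFreeGlobalLadderWitness
import Literature.AlgebraicGeometry.Hironaka2017.Lib.SpecOrders
import Literature.AlgebraicGeometry.Resolution.OriginLocalRing
import Literature.AlgebraicGeometry.Resolution.TauOne
import Mathlib.Algebra.MvPolynomial.PDeriv
import HarnessLib

/-!
# [OURS · L1 W4.6 rung (ii-τ2)] KERNEL WITNESS: the `A₂` threefold point `xy + z³` satisfies the hypotheses of the isolated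
# `τ ≥ 2` slice — its order-`2` locus is the origin alone, of order `2`, embedding dimension `3`, Hironaka `τ ≥ 2` — in EVERY
# characteristic; hence the slice applies and `(𝔸³_K, (xy + z³), 2)` is order-reducible

Cell res-hironaka, LADDER-RESOLUTION rung L (D-0089), slot W4.6, rung (ii) (threefold hypersurfaces); seat res-L1-s46-pv-3
(gen 4). Host route MarkedTransfer, host item `HypersurfaceOrderReductionDimLeThree` (stmt-ResolutionOfSingularities-16156);
filed `--kind proof --supports` it `--as helper`. NON-VACUITY of the isolated `τ ≥ 2` slice (p515229 / p516287) at an input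
with `τ = 2 < 3` (not covered by the maximal-`τ` slice p509471, nor by the monomial slice: `xy + z³` is not a monomial): the
surface double point `A₂ : xy + z³ = 0` in affine `3`-space over ANY field `K`. Kernel computations: the order-`2` locus of
`(xy + z³)` is the origin (derivations: `s·f ∈ 𝔓²`, `s ∉ 𝔓` force `∂f/∂x = y`, `∂f/∂y = x`, hence `z³`, in `𝔓`), the order at
the origin is exactly `2`, the local ring there has embedding dimension `3`, and `cl₂` contains the form `XY`, whose directrix is
not spanned by fewer than two linear forms. OURS bookkeeping; nothing of H. Hironaka's manuscript is asserted. AI-written;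
AI review is weaker than expert review.

## What is proved (no definitions besides the abbreviations of the witness)

* `CampaignW46.A2Witness.derivation_apply_mem` — `s ∉ 𝔓`, `s g ∈ 𝔓²` ⟹ `D g ∈ 𝔓` for every derivation `D` (prime `𝔓`).
* `CampaignW46.A2Witness.eq_origin_of_two_le_idealOrder` — the order-`2` locus of `(xy + z³)` on `Spec K[x,y,z]` is the origin.
* `CampaignW46.A2Witness.idealOrder_origin` — the order at the origin is `2`; `…spanFinrank_origin` — embedding dimension `3`;
  `…two_le_stalkTau_origin` — `τ ≥ 2` at the origin.
* `CampaignW46.A2Witness.orderReducible` — **`(𝔸³_K, (xy + z³)·𝒪, 2)` is ORDER-REDUCIBLE**, by the isolated `τ ≥ 2` slice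
  (finite-type form, p516287) applied to the kernel-checked hypotheses — for every field `K`.

References: `…ThreefoldsTauTwoSliceFiniteType.lean` (p516287), `…GammaFreeGlobalLadderWitness.lean` (affine-space binders),
tree `Hironaka2017/Lib/SpecOrders.lean` (`shf`, orders at prime points), `Resolution/OriginLocalRing.lean` (`originIdeal`,
`OriginLocalization`, `dim = n`), `Resolution/TauOne.lean` (`τ = 1` ⇒ powers of one linear form), `Resolution/HironakaDirectrixLemmas.lean`
(`τ = 0` ⇒ constants). [CossartPiltant2008] H. Hironaka, ms. 2017-03-23 — scope only, under adjudication, not cited as fact. [Hironaka2017]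
-/

noncomputable section

set_option linter.dupNamespace false -- mandated namespace of this single-conjunct summit

open CategoryTheory AlgebraicGeometry TopologicalSpace IsLocalRing MvPolynomial

namespace Summit.ResolutionOfSingularities.ResolutionOfSingularities.Theorems

namespace CampaignW46

namespace A2Witness

open Literature.AlgebraicGeometry.Resolution
open Literature.AlgebraicGeometry.Hironaka2017.SpecOrders
open Scheme.IdealSheafData

universe u

variable (K : Type u) [Field K]

/-- The coordinate ring `K[x, y, z]` of affine `3`-space. [folklore] -/
abbrev A3 : Type u := MvPolynomial (Fin 3) K

/-- The `A₂` polynomial `xy + z³`. [folklore] -/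
abbrev a2Poly : A3 K := X 0 * X 1 + X 2 ^ 3

/-- Its ideal sheaf on `𝔸³_K = Spec K[x, y, z]`. [folklore] -/
abbrev a2Sheaf : (Zs (A3 K)).IdealSheafData := shf (A3 K) (Ideal.span {a2Poly K})

/-- The origin of `𝔸³_K`. [folklore] -/
abbrev origin : Zs (A3 K) := ⟨originIdeal K 3, (originIdeal.isMaximal K 3).isPrime⟩

/-! ## §1 Algebra: derivations and symbolic squares; the order-`2` locus -/

variable {K}

/-- **Derivations detect symbolic squares**: for a prime `𝔓`, `s ∉ 𝔓` and `s g ∈ 𝔓²` imply `D g ∈ 𝔓` for every derivation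
`D` (`D(𝔓²) ⊆ 𝔓`, and `g ∈ 𝔓`). [folklore] -/
theorem derivation_apply_mem {P : Ideal (A3 K)} [P.IsPrime] (D : Derivation K (A3 K) (A3 K)) {s g : A3 K}
    (hs : s ∉ P) (h : s * g ∈ P ^ 2) : D g ∈ P := by
  have hsq : ∀ u ∈ P ^ 2, D u ∈ P := by
    intro u hu
    rw [pow_two] at hu
    refine Submodule.mul_induction_on hu (fun a ha b hb => ?_) (fun u v hu hv => ?_)
    · rw [Derivation.leibniz, smul_eq_mul, smul_eq_mul]
      exact P.add_mem (P.mul_mem_right _ ha) (P.mul_mem_right _ hb)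
    · rw [map_add]; exact P.add_mem hu hv
  have hg : g ∈ P := (Ideal.IsPrime.mem_or_mem ‹_› (Ideal.pow_le_self two_ne_zero h)).resolve_left hs
  have h1 : D (s * g) ∈ P := hsq _ h
  rw [Derivation.leibniz, smul_eq_mul, smul_eq_mul] at h1
  have h2 : s * D g ∈ P := by
    have h3 : g * D s ∈ P := P.mul_mem_right _ hg
    have := P.sub_mem h1 h3
    rwa [add_sub_cancel_right] at this
  exact (Ideal.IsPrime.mem_or_mem ‹_› h2).resolve_left hs

/-- `∂(xy + z³)/∂x = y`. [folklore] -/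
theorem pderiv_zero_a2Poly : pderiv 0 (a2Poly K) = X 1 := by
  simp only [map_add, Derivation.leibniz, Derivation.leibniz_pow, pderiv_X_self,
    pderiv_X_of_ne (show (1 : Fin 3) ≠ 0 by decide), pderiv_X_of_ne (show (2 : Fin 3) ≠ 0 by decide),
    smul_eq_mul, mul_one, mul_zero, smul_zero, zero_add, add_zero]

/-- `∂(xy + z³)/∂y = x`. [folklore] -/
theorem pderiv_one_a2Poly : pderiv 1 (a2Poly K) = X 0 := by
  simp only [map_add, Derivation.leibniz, Derivation.leibniz_pow, pderiv_X_self,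
    pderiv_X_of_ne (show (0 : Fin 3) ≠ 1 by decide), pderiv_X_of_ne (show (2 : Fin 3) ≠ 1 by decide),
    smul_eq_mul, mul_one, mul_zero, smul_zero, add_zero]

/-- **If `s (xy + z³) ∈ 𝔓²` with `s ∉ 𝔓` then `𝔓` is the origin**: `y = ∂_x f`, `x = ∂_y f` lie in `𝔓`, hence `z³ = f − xy`
and `z`. [folklore] -/
theorem originIdeal_le_of_mul_a2Poly_mem_sq {P : Ideal (A3 K)} [P.IsPrime] {s : A3 K} (hs : s ∉ P)
    (h : s * a2Poly K ∈ P ^ 2) : originIdeal K 3 ≤ P := by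
  have hy : (X 1 : A3 K) ∈ P := by
    have := derivation_apply_mem (pderiv 0) hs h; rwa [pderiv_zero_a2Poly] at this
  have hx : (X 0 : A3 K) ∈ P := by
    have := derivation_apply_mem (pderiv 1) hs h; rwa [pderiv_one_a2Poly] at this
  have hf : a2Poly K ∈ P := (Ideal.IsPrime.mem_or_mem ‹_› (Ideal.pow_le_self two_ne_zero h)).resolve_left hs
  have hz3 : (X 2 : A3 K) ^ 3 ∈ P := by
    have := P.sub_mem hf (P.mul_mem_right (X 1) hx)
    rwa [show a2Poly K - X 0 * X 1 = X 2 ^ 3 by rw [add_sub_cancel_left]] at this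
  have hz : (X 2 : A3 K) ∈ P := Ideal.IsPrime.mem_of_pow_mem ‹_› 3 hz3
  rw [originIdeal_eq_span, Ideal.span_le]
  rintro _ ⟨i, rfl⟩
  fin_cases i
  · exact hx
  · exact hy
  · exact hz

/-! ## §2 The order-`2` locus on `Spec K[x,y,z]` and the order at the origin -/

/-- **The order-`2` locus of `(xy + z³)·𝒪` is the origin** (every scheme point, closed or not). [folklore] -/
theorem eq_origin_of_two_le_idealOrder {x : Zs (A3 K)} (h : ((2 : ℕ) : ℕ∞) ≤ idealOrder (a2Sheaf K) x) :
    x = origin K := by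
  obtain ⟨s, hs, hsg⟩ := exists_mul_mem_pow_of_le_idealOrder (A3 K) (Ideal.span {a2Poly K}) x 2 h _
    (Ideal.mem_span_singleton_self _)
  haveI := x.isPrime
  have hle := originIdeal_le_of_mul_a2Poly_mem_sq hs hsg
  have heq : x.asIdeal = originIdeal K 3 := ((originIdeal.isMaximal K 3).eq_of_le x.isPrime.ne_top hle).symm
  exact PrimeSpectrum.ext heq

/-- Elements of `𝔪₀ⁿ` (the origin) have no monomials of degree `< n`. [folklore] -/
theorem coeff_eq_zero_of_mem_originIdeal_pow {n : ℕ} {u : A3 K} (hu : u ∈ originIdeal K 3 ^ n)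
    {m : Fin 3 →₀ ℕ} (hm : m.degree < n) : coeff m u = 0 := by
  induction n generalizing u m with
  | zero => exact absurd hm (Nat.not_lt_zero _)
  | succ n ih =>
    rw [pow_succ'] at hu
    refine Submodule.mul_induction_on hu (fun a ha b hb => ?_) (fun u v hu hv => by rw [coeff_add, hu, hv, add_zero])
    rw [coeff_mul]
    refine Finset.sum_eq_zero fun q hq => ?_
    rw [Finset.HasAntidiagonal.mem_antidiagonal] at hq
    by_cases hq1 : q.1 = 0
    · have ha0 : coeff q.1 a = 0 := by rw [hq1]; exact (mem_originIdeal_iff K 3).mp ha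
      rw [ha0, zero_mul]
    · have hdeg : q.2.degree < n := by
        have h1 : m.degree = q.1.degree + q.2.degree := by rw [← hq, map_add]
        have h2 : 0 < q.1.degree := by
          rw [pos_iff_ne_zero]
          exact fun h0 => hq1 ((Finsupp.degree_eq_zero_iff _).mp h0)
        omega
      rw [ih hb hdeg, mul_zero]

/-- `xy + z³ ∈ 𝔪₀²`. [folklore] -/
theorem a2Poly_mem_originIdeal_sq : a2Poly K ∈ originIdeal K 3 ^ 2 := by
  have hX : ∀ i, (X i : A3 K) ∈ originIdeal K 3 := fun i => by
    rw [mem_originIdeal_iff]; exact constantCoeff_X K i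
  refine Ideal.add_mem _ ?_ ?_
  · rw [pow_two]; exact Ideal.mul_mem_mul (hX 0) (hX 1)
  · exact Ideal.pow_le_pow_right (by norm_num) (Ideal.pow_mem_pow (hX 2) 3)

/-- **The order of `(xy + z³)·𝒪` at the origin is `2`.** [folklore] -/
theorem idealOrder_origin : idealOrder (a2Sheaf K) (origin K) = ((2 : ℕ) : ℕ∞) := by
  apply le_antisymm
  · -- no `s ∉ 𝔪₀` with `s (xy + z³) ∈ 𝔪₀³`: look at the coefficient of `xy`
    by_contra hlt
    rw [not_le] at hlt
    have h3 : ((3 : ℕ) : ℕ∞) ≤ idealOrder (a2Sheaf K) (origin K) := Order.add_one_le_of_lt hlt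
    obtain ⟨s, hs, hsg⟩ := exists_mul_mem_pow_of_le_idealOrder (A3 K) (Ideal.span {a2Poly K}) (origin K) 3 h3 _
      (Ideal.mem_span_singleton_self _)
    have hs0 : constantCoeff s ≠ 0 := fun h0 => hs ((mem_originIdeal_iff K 3).mpr h0)
    have hc := coeff_eq_zero_of_mem_originIdeal_pow hsg
      (m := Finsupp.single 0 1 + Finsupp.single 1 1) (by
        rw [map_add, Finsupp.degree_single, Finsupp.degree_single]; norm_num)
    apply hs0
    have key : coeff (Finsupp.single 0 1 + Finsupp.single 1 1) (s * a2Poly K) = constantCoeff s := by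
      rw [mul_add, coeff_add]
      have h1 : coeff (Finsupp.single 0 1 + Finsupp.single 1 1) (s * (X 0 * X 1 : A3 K)) = constantCoeff s := by
        rw [← mul_assoc, coeff_mul_X, show (Finsupp.single (0 : Fin 3) 1 : Fin 3 →₀ ℕ) = 0 + Finsupp.single 0 1 by
          rw [zero_add], coeff_mul_X, ← constantCoeff_eq]
      have h2 : coeff (Finsupp.single 0 1 + Finsupp.single 1 1) (s * (X 2 ^ 3 : A3 K)) = 0 := by
        refine coeff_eq_zero_of_mem_originIdeal_pow (n := 3) ?_ (by
          rw [map_add, Finsupp.degree_single, Finsupp.degree_single]; norm_num)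
        refine Ideal.mul_mem_left _ _ (Ideal.pow_mem_pow ?_ 3)
        rw [mem_originIdeal_iff]; exact constantCoeff_X K 2
      rw [h1, h2, add_zero]
    rw [← key]; exact hc
  · exact le_idealOrder_shf_of_le_pow (A3 K) _ (origin K) 2
      ((Ideal.span_singleton_le_iff_mem _).mpr a2Poly_mem_originIdeal_sq)

/-! ## §3 The origin: embedding dimension `3`, a regular system of parameters, `τ ≥ 2` -/

variable (K)

/-- **The local ring of `𝔸³_K` at the origin has embedding dimension `3`** (it is `K[x,y,z]_{(x,y,z)}`, regular of dimension
`3`). [folklore] -/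
theorem spanFinrank_origin : (maximalIdeal (St (A3 K) (origin K))).spanFinrank = 3 := by
  haveI : IsLocalization.AtPrime (St (A3 K) (origin K)) (originIdeal K 3) := isLocSt (A3 K) (origin K)
  let e : St (A3 K) (origin K) ≃ₐ[A3 K] OriginLocalization K 3 :=
    IsLocalization.algEquiv (originIdeal K 3).primeCompl _ _
  have h1 : (maximalIdeal (OriginLocalization K 3)).spanFinrank = 3 := by
    have h := IsRegularLocalRing.spanFinrank_maximalIdeal (R := OriginLocalization K 3)
    rw [ringKrullDim_originLocalization] at h
    exact_mod_cast h
  have h2 : (maximalIdeal (St (A3 K) (origin K))).spanFinrank = (maximalIdeal (OriginLocalization K 3)).spanFinrank := by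
    rw [← map_ringEquiv_maximalIdeal e.toRingEquiv, Ideal.spanFinrank_map_eq_of_ringEquiv]
  exact h2.trans h1

/-- The coordinates `x, y, z` in the local ring at the origin. [folklore] -/
abbrev cO : Fin 3 → St (A3 K) (origin K) := fun i => algebraMap (A3 K) (St (A3 K) (origin K)) (X i)

/-- They generate the maximal ideal. [folklore] -/
theorem span_range_cO : Ideal.span (Set.range (cO K)) = maximalIdeal (St (A3 K) (origin K)) := by
  rw [maximalIdeal_St, show (origin K).asIdeal = originIdeal K 3 from rfl, originIdeal_eq_span, Ideal.map_span,
    ← Set.range_comp]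
  rfl

/-- Evaluating a linear form. [folklore] -/
theorem eval_linearFormPoly {k : Type u} [Field k] {d : ℕ} (ℓ : Module.Dual k (Fin d → k)) (v : Fin d → k) :
    MvPolynomial.eval v (linearFormPoly k ℓ) = ℓ v := by
  rw [linearFormPoly, map_sum, dual_apply_eq_sum]
  refine Finset.sum_congr rfl fun i _ => ?_
  rw [map_mul, eval_C, eval_X, mul_comm]

/-- **`τ(XY) ≥ 2`**: the form `XY` is neither a constant nor a multiple of the square of one linear form (evaluate at `e₀`,
`e₁`, `e₀ + e₁`). [folklore] -/
theorem two_le_hironakaTau_X_mul_X (k : Type u) [Field k] :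
    2 ≤ hironakaTau k ({X 0 * X 1} : Set (MvPolynomial (Fin 3) k)) := by
  by_contra hlt
  rw [not_le] at hlt
  have h01 : hironakaTau k ({X 0 * X 1} : Set (MvPolynomial (Fin 3) k)) = 0 ∨
      hironakaTau k ({X 0 * X 1} : Set (MvPolynomial (Fin 3) k)) = 1 := by omega
  rcases h01 with h0 | h1
  · obtain ⟨a, ha⟩ := (hironakaTau_eq_zero_iff k _).mp h0 (Set.mem_singleton _)
    have e1 := congrArg (MvPolynomial.eval (fun _ => (1 : k))) ha
    have e0 := congrArg (MvPolynomial.eval (fun _ => (0 : k))) ha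
    simp only [eval_C, map_mul, eval_X, mul_one, mul_zero] at e1 e0
    exact one_ne_zero (e1.symm.trans e0)
  · obtain ⟨ℓ, -, -, hℓ⟩ := exists_forall_eq_C_mul_pow_of_hironakaTau_eq_one k h1
    obtain ⟨a, ha⟩ := hℓ (X 0 * X 1) (Set.mem_singleton _) 2 ((isHomogeneous_X k 0).mul (isHomogeneous_X k 1))
    have ev : ∀ v : Fin 3 → k, v 0 * v 1 = a * (ℓ v) ^ 2 := fun v => by
      have h := congrArg (MvPolynomial.eval v) ha
      simpa only [map_mul, eval_X, eval_C, map_pow, eval_linearFormPoly] using h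
    have h₀ := ev (Pi.single 0 1)
    have h₁ := ev (Pi.single 1 1)
    have h₂ := ev (Pi.single 0 1 + Pi.single 1 1)
    simp only [Pi.single_eq_same, Pi.single_eq_of_ne (show (1 : Fin 3) ≠ 0 by decide),
      Pi.single_eq_of_ne (show (0 : Fin 3) ≠ 1 by decide), Pi.add_apply, mul_zero, add_zero, zero_add,
      mul_one] at h₀ h₁ h₂
    rw [map_add] at h₂
    rcases mul_eq_zero.mp h₀.symm with ha0 | hl0
    · rw [ha0, zero_mul] at h₂; exact one_ne_zero h₂
    · rw [pow_eq_zero_iff two_ne_zero] at hl0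
      rw [hl0, zero_add] at h₂
      exact one_ne_zero (h₂.trans h₁.symm)

/-- **`XY ∈ cl₂((xy + z³)·𝒪)` at the origin**: the form `X₀X₁ + z·X₂²` (coefficient `z ∈ 𝔪`) evaluates to `xy + z³` and
reduces to `X₀X₁`. [folklore] -/
theorem X_mul_X_mem_initialForms :
    (X 0 * X 1 : MvPolynomial (Fin 3) (ResidueField (St (A3 K) (origin K)))) ∈
      initialForms (cO K) (stalkIdeal (a2Sheaf K) (origin K)) 2 := by
  refine (mem_initialForms_iff (cO K)).mpr ⟨X 0 * X 1 + C (cO K 2) * X 2 ^ 2, ?_, ?_, ?_⟩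
  · exact ((isHomogeneous_X _ 0).mul (isHomogeneous_X _ 1)).add
      ((isHomogeneous_C _ _).mul ((isHomogeneous_X _ 2).pow 2))
  · rw [stalkIdeal_shf]
    have h : MvPolynomial.eval (cO K) (X 0 * X 1 + C (cO K 2) * X 2 ^ 2) =
        algebraMap (A3 K) (St (A3 K) (origin K)) (a2Poly K) := by
      simp only [map_add, map_mul, map_pow, eval_X, eval_C, cO]
      ring
    rw [h]
    exact Ideal.mem_map_of_mem _ (Ideal.mem_span_singleton_self _)
  · have h2 : residue _ (cO K 2) = 0 := by
      rw [residue_eq_zero_iff, ← span_range_cO]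
      exact Ideal.subset_span ⟨2, rfl⟩
    simp only [map_add, map_mul, map_pow, map_X, map_C, h2, C_0, zero_mul, add_zero]

/-- **`τ ≥ 2` at the origin for `((xy + z³)·𝒪, 2)`** (indeed `τ = 2`; only the lower bound is recorded). [folklore] -/
theorem two_le_stalkTau_origin :
    haveI := LadderWitness.isRegular_affineSpace K 3 (origin K); 2 ≤ stalkTau (a2Sheaf K) (origin K) 2 := by
  haveI := LadderWitness.isRegular_affineSpace K 3 (origin K)
  rw [stalkTau_eq (a2Sheaf K) (origin K) 2 (spanFinrank_origin K) (cO K) (span_range_cO K), hironakaTauAt]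
  refine (two_le_hironakaTau_X_mul_X (ResidueField (St (A3 K) (origin K)))).trans ?_
  exact Submodule.finrank_mono (directrix_mono _ (Set.singleton_subset_iff.mpr (X_mul_X_mem_initialForms K)))

/-! ## §4 The slice applies -/

/-- **`(𝔸³_K, (xy + z³)·𝒪, 2)` IS ORDER-REDUCIBLE**, for every field `K`: the isolated `τ ≥ 2` slice (finite-type form, p516287)
applied to the kernel-checked hypotheses above. [folklore] -/
theorem orderReducible : OrderReducible (a2Sheaf K) 2 := by
  have hX := LadderWitness.isRegular_affineSpace K 3
  haveI := LadderWitness.locallyOfFiniteType_affineSpace K 3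
  refine orderReducible_of_finite_two_le_tau_of_locallyOfFiniteType
    (Spec.map (CommRingCat.ofHom (algebraMap K (A3 K)))) hX (a2Sheaf K) (by norm_num) {origin K}
    (Set.finite_singleton _) (fun x hx => ?_) (fun x hx => ?_) (fun x hx => ?_) (fun x hx => ?_) (fun x hx => ?_)
  · rw [Set.mem_singleton_iff.mp hx]
    exact (PrimeSpectrum.isClosed_singleton_iff_isMaximal _).mpr (originIdeal.isMaximal K 3)
  · exact Set.mem_singleton_iff.mpr (eq_origin_of_two_le_idealOrder hx)
  · rw [Set.mem_singleton_iff.mp hx]; exact idealOrder_origin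
  · rw [Set.mem_singleton_iff.mp hx]; exact spanFinrank_origin K
  · obtain rfl := Set.mem_singleton_iff.mp hx
    exact two_le_stalkTau_origin K

/-- **NON-VACUITY OF THE ISOLATED `τ ≥ 2` SLICE, packaged**: for every field `K` there are a regular scheme locally of finite type
over `K` — affine `3`-space — an ideal — `(xy + z³)` — and a point — the origin — meeting every hypothesis of
`orderReducible_of_finite_two_le_tau_of_locallyOfFiniteType` with `S` that single point. [folklore] -/
theorem exists_input_isolated_two_le_tau :
    ∃ (X : Scheme.{u}) (s : X ⟶ Spec (.of K)) (_ : LocallyOfFiniteType s) (hX : Scheme.IsRegular X)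
      (J : X.IdealSheafData) (ξ : X), IsClosed ({ξ} : Set X) ∧
      (∀ x : X, ((2 : ℕ) : ℕ∞) ≤ idealOrder J x → x ∈ ({ξ} : Set X)) ∧ idealOrder J ξ = ((2 : ℕ) : ℕ∞) ∧
      (maximalIdeal (X.presheaf.stalk ξ)).spanFinrank = 3 ∧ (haveI := hX ξ; 2 ≤ stalkTau J ξ 2) :=
  ⟨Zs (A3 K), Spec.map (CommRingCat.ofHom (algebraMap K (A3 K))), LadderWitness.locallyOfFiniteType_affineSpace K 3,
    LadderWitness.isRegular_affineSpace K 3, a2Sheaf K, origin K,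
    (PrimeSpectrum.isClosed_singleton_iff_isMaximal _).mpr (originIdeal.isMaximal K 3),
    fun _ hx => Set.mem_singleton_iff.mpr (eq_origin_of_two_le_idealOrder hx), idealOrder_origin,
    spanFinrank_origin K, two_le_stalkTau_origin K⟩

end A2Witness

end CampaignW46

end Summit.ResolutionOfSingularities.ResolutionOfSingularities.Theorems

end
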